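import Mathlib
import Literature.Analysis.FluidPDE.SelfSimilarEulerProfileVorticity
import Literature.Analysis.ODE.LinearConeDichotomy
import Literature.Analysis.ODE.LipschitzFlow
import HarnessLib.Audit

/-!
# Rung C1 of the crux `EulerZoomLiouville.PowerGaugeEulerLiouville`: the CONE LEMMA at a point whose
# linearised transport field admits a strict cone certificate — backward-trapped points are thin

Route №10 `EulerZoomLiouville` (NavierStokesRegularity), crux E = stmt-NavierStokesRegularity-19832,
tenure rung C1 (exactly self-similar members), registered residue `stub_selfSimilarExtremal`.
PROFILE-LEVEL toolkit, second file of the NODAL-FINITENESS chain (lineage ns-typeII-p2, gen 6).  For a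
`C²` self-similar Euler profile `(U, P)` (CIV 2026 (3.3)) with transport field `V = γ(y − c) + U`
and a point `z` (in the application: a stagnation point) such that `M = DV(z)` admits a STRICT CONE
CERTIFICATE — a continuous bilinear form `Q` with `Q(e, e) > 0` for some `e`, and constants
`η > 0`, `θ ≤ 0` with

  `Q(Mv, v) + Q(v, Mv) ≤ 2θ Q(v, v) − η‖v‖²` for all `v`

(this exists iff `M` has an eigenvalue of NEGATIVE real part: take `Q = |π₁ ·|² − C|π₂ ·|²` for the
spectral splitting at the lowest real part and `θ` in the spectral gap; at a stagnation point of an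
in-window profile carrying vorticity it always exists, since `tr DV(z) = 3γ < 1 + γ ≤ maxRe spec`) —
we prove:

* `eq_of_backward_trajectories_near_of_coneCertificate` — **the cone lemma**: there is `δ > 0` such
  that two BACKWARD trajectories (`p' = −V(p)`) staying in `B̄(z, δ)` for all `t ≥ 0` whose initial
  difference lies in the closed cone `{Q ≥ 0}` coincide.  (Mean value inequality for `V − M` on the
  ball + the abstract cone lemma `Literature.Analysis.ODE.eq_zero_of_bounded_of_cone_certificate_deriv`.)
* `interior_backwardTrapped_eq_empty` — consequently the set
  `Λ_δ(z) = {x : Φ_{−t}(x) ∈ B̄(z, δ) for all t ≥ 0}` of points whose whole backward orbit under the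
  (global, `V` Lipschitz) self-similar Lagrangian flow stays `δ`-close to `z` has EMPTY INTERIOR (it
  meets every line `x + ℝe` at most once), and `isClosed_backwardTrapped`: it is closed.

Third file (`…SelfSimilarFiniteNodalSet`): Baire-category assembly with the KILL step of
`…SelfSimilarVorticityTransport`.

WHAT THIS IS NOT: not NS, not E, not rung C1 — a dynamical lemma about classical profiles; nothing
here uses the far field or the Euler equation beyond `V ∈ C¹`.

## References

* P. Constantin, M. Ignatova, V. Vicol, arXiv:2602.17570 (2026), §3.4.1–§3.5 (self-similar
  Lagrangian flow, stagnation points, Remark 3.6 on stable manifolds). [ConstantinIgnatovaVicol2026Putative]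
* A. Katok, B. Hasselblatt, *Introduction to the Modern Theory of Dynamical Systems*, CUP 1995, §6.2
  (cone criterion). [KatokHasselblatt1995]
-/

noncomputable section

-- flat `Theorems/<Route><Decl>…` files of one crux share the namespace of the crux (tree convention)
set_option linter.dupNamespace false

open Set Filter Topology Metric Function
open scoped NNReal

namespace Summit.NavierStokesRegularity.NavierStokesRegularity.Theorems.PowerGaugeEulerLiouville.NodalFiniteness

open Literature.Analysis Literature.Analysis.FluidPDE Literature.Analysis.ODE

variable {γ : ℝ} {c : EuclideanSpace ℝ (Fin 3)}
  {U : EuclideanSpace ℝ (Fin 3) → EuclideanSpace ℝ (Fin 3)} {P : EuclideanSpace ℝ (Fin 3) → ℝ}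

/-! ### The mean value remainder of `V` near `z` -/

/-- `V` is differentiable with `DV(y) = γ I + DU(y)`. [cite: ConstantinIgnatovaVicol2026Putative, §3.4 eq. (3.19)] -/
private theorem hasFDerivAt_transport (h : IsSelfSimilarEulerProfile γ c U P)
    (y : EuclideanSpace ℝ (Fin 3)) :
    HasFDerivAt (selfSimilarTransport γ c U) (fderiv ℝ (selfSimilarTransport γ c U) y) y :=
  (hasFDerivAt_selfSimilarTransport h.differentiable_velocity y).differentiableAt.hasFDerivAt

/-- `y ↦ DV(y)` is continuous. [cite: ConstantinIgnatovaVicol2026Putative, §3.4 eq. (3.19)] -/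
private theorem continuous_fderiv_transport' (h : IsSelfSimilarEulerProfile γ c U P) :
    Continuous fun y => fderiv ℝ (selfSimilarTransport γ c U) y := by
  have e : (fun y => fderiv ℝ (selfSimilarTransport γ c U) y) =
      fun y => γ • ContinuousLinearMap.id ℝ (EuclideanSpace ℝ (Fin 3)) + fderiv ℝ U y :=
    funext fun y => (hasFDerivAt_selfSimilarTransport h.differentiable_velocity y).fderiv
  rw [e]
  exact continuous_const.add (h.contDiff_velocity.continuous_fderiv (by norm_num))

/-- **Uniform linearisation on a small ball.** For every `ρ > 0` there is `δ > 0` such that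
`‖(V x − V y) − DV(z)(x − y)‖ ≤ ρ‖x − y‖` for all `x, y ∈ B̄(z, δ)` (continuity of `DV` at `z` and the
mean value inequality for `V − DV(z)` on the convex ball). [folklore] -/
theorem exists_ball_linearisation (h : IsSelfSimilarEulerProfile γ c U P) (z : EuclideanSpace ℝ (Fin 3))
    {ρ : ℝ} (hρ : 0 < ρ) :
    ∃ δ > 0, ∀ x ∈ closedBall z δ, ∀ y ∈ closedBall z δ,
      ‖(selfSimilarTransport γ c U x - selfSimilarTransport γ c U y) -
        fderiv ℝ (selfSimilarTransport γ c U) z (x - y)‖ ≤ ρ * ‖x - y‖ := by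
  set V := selfSimilarTransport γ c U with hV
  set M := fderiv ℝ V z with hM
  -- continuity of `DV` at `z`
  have hc : ContinuousAt (fun y => fderiv ℝ V y) z := (continuous_fderiv_transport' h).continuousAt
  obtain ⟨δ, hδ, hball⟩ := Metric.continuousAt_iff.1 hc ρ hρ
  refine ⟨δ / 2, by positivity, fun x hx y hy => ?_⟩
  -- the auxiliary map `f = V - M`
  set f : EuclideanSpace ℝ (Fin 3) → EuclideanSpace ℝ (Fin 3) := fun w => V w - M w with hf
  have hfd : ∀ w ∈ closedBall z (δ / 2), HasFDerivWithinAt f (fderiv ℝ V w - M) (closedBall z (δ / 2)) w :=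
    fun w _ => ((hasFDerivAt_transport h w).sub M.hasFDerivAt).hasFDerivWithinAt
  have hbound : ∀ w ∈ closedBall z (δ / 2), ‖fderiv ℝ V w - M‖ ≤ ρ := by
    intro w hw
    have hw' : dist w z < δ := lt_of_le_of_lt (mem_closedBall.1 hw) (by linarith)
    have := hball hw'
    rw [dist_eq_norm] at this
    exact this.le
  have hmv := (convex_closedBall z (δ / 2)).norm_image_sub_le_of_norm_hasFDerivWithin_le hfd hbound hy hx
  -- `f x - f y = (V x - V y) - M (x - y)`
  have e : f x - f y = (V x - V y) - M (x - y) := by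
    simp only [hf, map_sub]; abel
  rw [← e]
  exact hmv

/-! ### The cone lemma for backward trajectories near `z` -/

/-- **THE CONE LEMMA.** Let `(U, P)` be a `C²` self-similar Euler profile, `V = γ(y−c) + U`, and let
`z` be a point whose linearised field `M = DV(z)` admits a strict cone certificate: a continuous
bilinear form `Q` and `η > 0`, `θ ≤ 0` with `Q(Mv, v) + Q(v, Mv) ≤ 2θ Q(v,v) − η‖v‖²` for all `v`.
Then there is `δ > 0` such that: if two backward trajectories `p, p'` (`p' = −V(p)`) stay in
`B̄(z, δ)` for all `t ≥ 0` and `Q(p(0) − p'(0), p(0) − p'(0)) ≥ 0`, then `p(0) = p'(0)`.  Proof: the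
difference `d = p − p'` satisfies `d' = −(V(p) − V(p')) = −M d − r`, `‖r‖ ≤ ρ‖d‖` on the ball
(`exists_ball_linearisation`); with `ρ = η/(4(‖Q‖+1))` the certificate survives along `d` in the
reversed-time form `Q(d', d) + Q(d, d') ≥ (η/2)‖d‖² + 2|θ| Q(d,d)`, and a bounded solution starting
in the closed cone is trivial (`Literature.Analysis.ODE.eq_zero_of_bounded_of_cone_certificate_deriv`).
[cite: KatokHasselblatt1995, §6.2 (cone criterion)] [cite: ConstantinIgnatovaVicol2026Putative, §3.4.3 Remark 3.6] -/
theorem eq_of_backward_trajectories_near_of_coneCertificate (h : IsSelfSimilarEulerProfile γ c U P)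
    (z : EuclideanSpace ℝ (Fin 3))
    (Q : EuclideanSpace ℝ (Fin 3) →L[ℝ] EuclideanSpace ℝ (Fin 3) →L[ℝ] ℝ) {η θ : ℝ} (hη : 0 < η)
    (hθ : θ ≤ 0)
    (hcert : ∀ v, Q (fderiv ℝ (selfSimilarTransport γ c U) z v) v +
      Q v (fderiv ℝ (selfSimilarTransport γ c U) z v) ≤ 2 * θ * Q v v - η * ‖v‖ ^ 2) :
    ∃ δ > 0, ∀ p p' : ℝ → EuclideanSpace ℝ (Fin 3),
      (∀ t, HasDerivAt p ((-1 : ℝ) • selfSimilarTransport γ c U (p t)) t) →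
      (∀ t, HasDerivAt p' ((-1 : ℝ) • selfSimilarTransport γ c U (p' t)) t) →
      (∀ t, 0 ≤ t → p t ∈ closedBall z δ) → (∀ t, 0 ≤ t → p' t ∈ closedBall z δ) →
      0 ≤ Q (p 0 - p' 0) (p 0 - p' 0) → p 0 = p' 0 := by
  set V := selfSimilarTransport γ c U with hV
  set M := fderiv ℝ V z with hM
  set ρ : ℝ := η / (4 * (‖Q‖ + 1)) with hρ
  have hρpos : 0 < ρ := by positivity
  obtain ⟨δ, hδ, hlin⟩ := exists_ball_linearisation h z hρpos
  refine ⟨δ, hδ, fun p p' hp hp' hpB hp'B h0 => ?_⟩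
  -- the difference and its derivative
  set d : ℝ → EuclideanSpace ℝ (Fin 3) := fun t => p t - p' t with hd
  set e : ℝ → EuclideanSpace ℝ (Fin 3) := fun t => -(V (p t) - V (p' t)) with he
  have hd' : ∀ t, 0 ≤ t → HasDerivAt d (e t) t := by
    intro t _
    have := (hp t).sub (hp' t)
    refine this.congr_deriv ?_
    simp only [he, neg_smul, one_smul]
    abel
  -- the certificate along `d`
  have hA : ∀ t, 0 ≤ t → (η / 2) * ‖d t‖ ^ 2 + 2 * (-θ) * Q (d t) (d t) ≤
      Q (e t) (d t) + Q (d t) (e t) := by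
    intro t ht
    set r : EuclideanSpace ℝ (Fin 3) := (V (p t) - V (p' t)) - M (d t) with hr
    have hrle : ‖r‖ ≤ ρ * ‖d t‖ := hlin (p t) (hpB t ht) (p' t) (hp'B t ht)
    have he' : e t = -(M (d t)) - r := by simp only [he, hr]; abel
    have hQr : |Q r (d t) + Q (d t) r| ≤ 2 * ‖Q‖ * ρ * ‖d t‖ ^ 2 := by
      have h1 : |Q r (d t)| ≤ ‖Q‖ * ρ * ‖d t‖ ^ 2 := by
        calc |Q r (d t)| = ‖Q r (d t)‖ := (Real.norm_eq_abs _).symm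
          _ ≤ ‖Q‖ * ‖r‖ * ‖d t‖ := Q.le_opNorm₂ _ _
          _ ≤ ‖Q‖ * (ρ * ‖d t‖) * ‖d t‖ := by gcongr
          _ = ‖Q‖ * ρ * ‖d t‖ ^ 2 := by ring
      have h2 : |Q (d t) r| ≤ ‖Q‖ * ρ * ‖d t‖ ^ 2 := by
        calc |Q (d t) r| = ‖Q (d t) r‖ := (Real.norm_eq_abs _).symm
          _ ≤ ‖Q‖ * ‖d t‖ * ‖r‖ := Q.le_opNorm₂ _ _
          _ ≤ ‖Q‖ * ‖d t‖ * (ρ * ‖d t‖) := by gcongr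
          _ = ‖Q‖ * ρ * ‖d t‖ ^ 2 := by ring
      calc |Q r (d t) + Q (d t) r| ≤ |Q r (d t)| + |Q (d t) r| := abs_add_le _ _
        _ ≤ _ := by linarith
    have hsplit : Q (e t) (d t) + Q (d t) (e t) =
        -(Q (M (d t)) (d t) + Q (d t) (M (d t))) - (Q r (d t) + Q (d t) r) := by
      rw [he']
      simp only [map_sub, map_neg, sub_apply, neg_apply]
      ring
    have hc := hcert (d t)
    have hρQ : 2 * ‖Q‖ * ρ ≤ η / 2 := by
      rw [hρ]
      have hQ1 : 0 < ‖Q‖ + 1 := by positivity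
      rw [show 2 * ‖Q‖ * (η / (4 * (‖Q‖ + 1))) = (‖Q‖ / (‖Q‖ + 1)) * (η / 2) by field_simp; ring]
      have : ‖Q‖ / (‖Q‖ + 1) ≤ 1 := by rw [div_le_one hQ1]; linarith
      calc ‖Q‖ / (‖Q‖ + 1) * (η / 2) ≤ 1 * (η / 2) :=
            mul_le_mul_of_nonneg_right this (by positivity)
        _ = η / 2 := one_mul _
    have hr2 : Q r (d t) + Q (d t) r ≤ (η / 2) * ‖d t‖ ^ 2 := by
      calc Q r (d t) + Q (d t) r ≤ 2 * ‖Q‖ * ρ * ‖d t‖ ^ 2 := (le_abs_self _).trans hQr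
        _ ≤ (η / 2) * ‖d t‖ ^ 2 := mul_le_mul_of_nonneg_right hρQ (sq_nonneg _)
    rw [hsplit]
    linarith
  -- boundedness of `d` on `[0, ∞)`
  have hR : ∀ t, 0 ≤ t → ‖d t‖ ≤ 2 * δ := by
    intro t ht
    have h1 := mem_closedBall.1 (hpB t ht)
    have h2 := mem_closedBall.1 (hp'B t ht)
    rw [dist_eq_norm] at h1 h2
    calc ‖d t‖ = ‖(p t - z) - (p' t - z)‖ := by simp only [hd]; abel_nf
      _ ≤ ‖p t - z‖ + ‖p' t - z‖ := norm_sub_le _ _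
      _ ≤ 2 * δ := by linarith
  have h00 : 0 ≤ Q (d 0) (d 0) := h0
  have := eq_zero_of_bounded_of_cone_certificate_deriv Q (by positivity : 0 < η / 2)
    (by linarith : 0 ≤ -θ) hd' hA hR h00
  exact sub_eq_zero.1 this

/-! ### The backward-trapped set of `z` has empty interior -/

/-- **Backward-trapped points are thin.** Under the strict cone certificate at `z` (with a vector
`e` in the open cone, `Q(e,e) > 0`) and a global Lipschitz bound for `V` (so that the self-similar
Lagrangian flow `Φ = lipschitzFlow` is global), with `δ` from the cone lemma: the set
`Λ_δ(z) = {x : Φ_{−t}(x) ∈ B̄(z, δ) ∀ t ≥ 0}` has EMPTY INTERIOR — a ball inside it would contain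
`x` and `x + s e`, two distinct backward-trapped points whose difference lies in the cone.
[cite: KatokHasselblatt1995, §6.2 (cone criterion)] [cite: ConstantinIgnatovaVicol2026Putative, §3.4.3 Remark 3.6] -/
theorem interior_backwardTrapped_eq_empty (h : IsSelfSimilarEulerProfile γ c U P)
    {K : ℝ≥0} (hK : LipschitzWith K (selfSimilarTransport γ c U)) (z : EuclideanSpace ℝ (Fin 3))
    (Q : EuclideanSpace ℝ (Fin 3) →L[ℝ] EuclideanSpace ℝ (Fin 3) →L[ℝ] ℝ) {η θ : ℝ} (hη : 0 < η)
    (hθ : θ ≤ 0)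
    (hcert : ∀ v, Q (fderiv ℝ (selfSimilarTransport γ c U) z v) v +
      Q v (fderiv ℝ (selfSimilarTransport γ c U) z v) ≤ 2 * θ * Q v v - η * ‖v‖ ^ 2)
    {e : EuclideanSpace ℝ (Fin 3)} (he : 0 < Q e e) :
    ∃ δ > 0, interior {x : EuclideanSpace ℝ (Fin 3) |
      ∀ t, 0 ≤ t → lipschitzFlow hK x (-t) ∈ closedBall z δ} = ∅ := by
  obtain ⟨δ, hδ, hcone⟩ := eq_of_backward_trajectories_near_of_coneCertificate h z Q hη hθ hcert
  refine ⟨δ, hδ, ?_⟩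
  set Λ := {x : EuclideanSpace ℝ (Fin 3) | ∀ t, 0 ≤ t → lipschitzFlow hK x (-t) ∈ closedBall z δ}
    with hΛ
  rw [eq_empty_iff_forall_notMem]
  intro x hx
  rw [mem_interior_iff_mem_nhds, Metric.mem_nhds_iff] at hx
  obtain ⟨ε, hε, hball⟩ := hx
  -- a second point `x + s • e` in the ball
  have he0 : e ≠ 0 := by
    rintro rfl; simp at he
  set s : ℝ := ε / (2 * ‖e‖) with hs
  have hspos : 0 < s := by
    have : 0 < ‖e‖ := norm_pos_iff.2 he0
    positivity
  have hx' : x + s • e ∈ ball x ε := by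
    rw [mem_ball, dist_eq_norm, add_sub_cancel_left, norm_smul, Real.norm_eq_abs, abs_of_pos hspos,
      hs, div_mul_eq_mul_div, mul_comm ε, ← div_mul_eq_mul_div]
    have : ‖e‖ / (2 * ‖e‖) = 1 / 2 := by
      have : 0 < ‖e‖ := norm_pos_iff.2 he0
      field_simp
    rw [this]; linarith
  have hxΛ : x ∈ Λ := hball (mem_ball_self hε)
  have hx'Λ : x + s • e ∈ Λ := hball hx'
  -- the two backward trajectories
  set p : ℝ → EuclideanSpace ℝ (Fin 3) := fun t => lipschitzFlow hK (x + s • e) (-t) with hp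
  set p' : ℝ → EuclideanSpace ℝ (Fin 3) := fun t => lipschitzFlow hK x (-t) with hp'
  have hderiv : ∀ (q : EuclideanSpace ℝ (Fin 3)) (t : ℝ),
      HasDerivAt (fun t => lipschitzFlow hK q (-t))
        ((-1 : ℝ) • selfSimilarTransport γ c U (lipschitzFlow hK q (-t))) t := by
    intro q t
    have h1 := hasDerivAt_lipschitzFlow hK q (-t)
    exact h1.scomp t (hasDerivAt_neg t)
  have hpd : ∀ t, HasDerivAt p ((-1 : ℝ) • selfSimilarTransport γ c U (p t)) t :=
    fun t => hderiv _ t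
  have hp'd : ∀ t, HasDerivAt p' ((-1 : ℝ) • selfSimilarTransport γ c U (p' t)) t :=
    fun t => hderiv _ t
  have hdiff : p 0 - p' 0 = s • e := by
    simp only [hp, hp', neg_zero, lipschitzFlow_zero, add_sub_cancel_left]
  have h0 : 0 ≤ Q (p 0 - p' 0) (p 0 - p' 0) := by
    rw [hdiff, map_smul, map_smul, smul_apply, smul_eq_mul, smul_eq_mul]
    exact (mul_pos hspos (mul_pos hspos he)).le
  have heq := hcone p p' hpd hp'd (fun t ht => hx'Λ t ht) (fun t ht => hxΛ t ht) h0
  simp only [hp, hp', neg_zero, lipschitzFlow_zero, add_eq_left] at heq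
  exact he0 (smul_eq_zero.1 heq |>.resolve_left hspos.ne')

/-- The backward-trapped set `Λ_δ(z)` is closed (each `x ↦ Φ_{−t}(x)` is continuous — joint
continuity of the flow of a `C¹` Lipschitz field). [folklore] -/
theorem isClosed_backwardTrapped (h : IsSelfSimilarEulerProfile γ c U P)
    {K : ℝ≥0} (hK : LipschitzWith K (selfSimilarTransport γ c U)) (z : EuclideanSpace ℝ (Fin 3))
    (δ : ℝ) (T : ℝ) :
    IsClosed {x : EuclideanSpace ℝ (Fin 3) |
      ∀ t, T ≤ t → lipschitzFlow hK x (-t) ∈ closedBall z δ} := by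
  have hV1 : ContDiff ℝ 1 (selfSimilarTransport γ c U) := by
    have e : selfSimilarTransport γ c U = fun y => γ • (y - c) + U y := rfl
    rw [e]
    exact ((contDiff_id.sub contDiff_const).const_smul γ).add (h.contDiff_velocity.of_le (by norm_num))
  have hjoint := (contDiff_lipschitzFlow hV1 le_rfl hK).continuous
  have hcont : ∀ t : ℝ, Continuous fun x : EuclideanSpace ℝ (Fin 3) => lipschitzFlow hK x (-t) :=
    fun t => hjoint.comp (Continuous.prodMk_left (-t))
  have e : {x : EuclideanSpace ℝ (Fin 3) | ∀ t, T ≤ t → lipschitzFlow hK x (-t) ∈ closedBall z δ} =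
      ⋂ t ∈ Ici T, (fun x => lipschitzFlow hK x (-t)) ⁻¹' closedBall z δ := by
    ext x; simp
  rw [e]
  exact isClosed_biInter fun t _ => isClosed_closedBall.preimage (hcont t)

end Summit.NavierStokesRegularity.NavierStokesRegularity.Theorems.PowerGaugeEulerLiouville.NodalFiniteness
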